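import Mathlib.Algebra.MvPolynomial.Degrees
import Literature.Computability.AlgebraicComplexity.ArithCircuit
import HarnessLib

/-!
# Kaltofen's theorem: factors of polynomials with small circuits have small circuits (NAMED FACT)

Topic `Computability/AlgebraicComplexity`. E. Kaltofen, *Factorization of polynomials given by
straight-line programs* (Randomness and Computation, 1989; announced STOC 1986/87, "Uniform
closure properties of p-computable functions"): over a field of characteristic zero, if a
polynomial `f` of (total) degree `d` is computed by an arithmetic circuit of size `s`, then
EVERY factor `g` of `f` is computed by an arithmetic circuit of size polynomial in `s` and `d`.
Printed form used here: P. Bürgisser, *Completeness classes in algebraic complexity theory*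
(2024), Thm. 3.2: "Suppose the multivariate polynomial `f` of degree `d` over a field `𝔽` of
characteristic zero is computed by an arithmetic circuit of size `s`. Then any factor `g` of `f`
can be computed by an arithmetic circuit of size polynomially bounded in `s` and `d`." (Cor. 3.3:
`VP` is closed under taking factors; "This closedness result is a crucial ingredient in the
seminal hardness versus randomness results of Kabanets and Impagliazzo".)

**What this file does.** It states the theorem as a NAMED FACT (`def … : Prop`, D-0014) in the
tree's circuit model (`complexity` = fan-in-two size with free constants and inputs, Bürgisser's
`L` up to a factor `≤ 3`, `ArithCircuit.lean`), with the polynomial bound in the fixed shape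
`(s + d + 2) ^ κ` for ONE absolute exponent `κ` (equivalent to "polynomially bounded in `s` and
`d`": every polynomial in `s, d` is eventually below such a power, and the `+ 2` makes the base
`≥ 2` so that small cases need no side conditions): `KaltofenFactorBoundWith F κ` (the bound with
a given exponent) and `KaltofenFactorBound F := ∃ κ, KaltofenFactorBoundWith F κ`. Variables are
`Fin n` for every `n` with `κ` independent of `n` (as in print: the bound does not mention the
number of variables — a factor of a nonzero `f` only involves variables of `f`). Nothing is
proved here; users take `(hK : KaltofenFactorBoundWith F κ)` as a hypothesis (conditional
results), e.g. the Kabanets–Impagliazzo generator (`KabanetsImpagliazzoGenerator.lean`).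

**Scope.** Printed and true in characteristic ZERO (the tree's summit field `ℂ`). In positive
characteristic `p` only a weaker statement holds (Kaltofen's algorithm returns `g^{p^k}` for
factors of multiplicity divisible by `p`; Kabanets–Impagliazzo 2003, Thm. 27), which is NOT what
this `def` says — so the `def`s carry `[CharZero F]` and say nothing over such fields. Not here
either: the uniform / randomised algorithmic content (Kaltofen's
theorem is an ALGORITHM; only the existence of small circuits is recorded), Bürgisser's Factor
Conjecture (bound polynomial in `s` and `deg g` only; Bürgisser 2024, after Thm. 3.4) and its
border version.

## References

* [Kaltofen1989] E. Kaltofen, *Factorization of polynomials given by straight-line programs*, in: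
  Randomness and Computation (S. Micali, ed.), Adv. Comput. Res. 5, JAI Press 1989, 375–412.
* [Burgisser2024Completeness] P. Bürgisser, *Completeness classes in algebraic complexity theory*,
  arXiv:2406.06217, Thm. 3.2 and Cor. 3.3.
* [KabanetsImpagliazzo2003] V. Kabanets, R. Impagliazzo, *Derandomizing polynomial identity tests
  means proving circuit lower bounds*, STOC 2003, Thm. 27 and Cor. 29.
-/

noncomputable section

namespace Literature.Computability.AlgebraicComplexity

open MvPolynomial

/-- **Kaltofen's factor bound with exponent `κ`** (the quantitative content of Bürgisser 2024,
Thm. 3.2, in the fixed polynomial shape `(s + d + 2)^κ`): for every number of variables `n` and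
all `f, g ∈ F[x_1, …, x_n]` with `f ≠ 0` and `g ∣ f`,
`L(g) ≤ (L(f) + deg f + 2) ^ κ`, where `L = complexity` (fan-in-two circuit size, constants free)
and `deg` is the total degree. A THEOREM (for a suitable absolute `κ`) when `F` has characteristic
zero (the only case in which it is stated: `[CharZero F]`); see `KaltofenFactorBound`.
[cite: Burgisser2024Completeness, Thm. 3.2] -/
def KaltofenFactorBoundWith (F : Type*) [Field F] [CharZero F] (κ : ℕ) : Prop :=
  ∀ (n : ℕ) (f g : MvPolynomial (Fin n) F), f ≠ 0 → g ∣ f →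
    complexity g ≤ (complexity f + f.totalDegree + 2) ^ κ

/-- **Kaltofen's theorem (NAMED FACT; Kaltofen 1989, Bürgisser 2024 Thm. 3.2):** "Suppose the
multivariate polynomial `f` of degree `d` over a field `𝔽` of characteristic zero is computed by
an arithmetic circuit of size `s`. Then any factor `g` of `f` can be computed by an arithmetic
circuit of size polynomially bounded in `s` and `d`" — here: some absolute exponent `κ` works in
`KaltofenFactorBoundWith F κ`. Stated for characteristic zero only (`[CharZero F]`; in positive
characteristic only `g^{p^k}` is obtained); unproved in the tree — a conditional hypothesis for
hardness-vs-randomness results. [cite: Burgisser2024Completeness, Thm. 3.2] -/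
def KaltofenFactorBound (F : Type*) [Field F] [CharZero F] : Prop :=
  ∃ κ : ℕ, KaltofenFactorBoundWith F κ

/-- The bound is monotone in the exponent (the base is `≥ 2`), so any two users may agree on a
common `κ`. [cite: Burgisser2024Completeness, Thm. 3.2] -/
theorem KaltofenFactorBoundWith.mono {F : Type*} [Field F] [CharZero F] {κ κ' : ℕ}
    (h : KaltofenFactorBoundWith F κ) (hκ : κ ≤ κ') : KaltofenFactorBoundWith F κ' :=
  fun n f g hf hg => (h n f g hf hg).trans (Nat.pow_le_pow_right (by omega) hκ)

end Literature.Computability.AlgebraicComplexity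

end
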